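import Summits.QuantumFields.BalabanUV.Beta.CompositeMixedTableGraded

/-!
# `BalabanUV.Beta.CompositeMixedTableGradedCov` — binder row D1 ∕ (C1), PART 79a: **THE GRADED COMPOSITE MIXED KERNEL's REMAINING LETTERS** — support in the two
# fluctuation bonds, BLOCK-TRANSLATION COVARIANCE, the packed table's (Tmix)-shape covariance at blocking `L^m`, and the (0.4)-sym family's covariance and depth-one anchor
# (F6c `CompositeMixedTable` §3–§5 ∕ F6c-2 `CompositeMixedTableBounds` §4 verbatim for (F0)'s recursion; the third summand's sign is immaterial to every one of them)

WHY (journal [AN2-G81-STAGED-1] ∕ J-NOTE-26 §6 (2)).  PART 78b gave (K2b) for (F0)'s graded kernel `compMixKerG` on the infinite lattice as the displayed single commutator at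
every depth; its torus form (PART 79b, the coarse-slot-periodised even graded table along a torus pure gauge — PART 26∕33's engine applied to ONE commutator) needs the same
three letters PART 33a needed of F6c's `compMix`: finite support in every bond (windows `winF (L^m) (wid L m)`), joint block-translation covariance (to periodise), and the
packed family's entries.  (F0) has the entries (`compMixFFG_inl_inl ∕ compMixG_inl_inl`) and PART 78a the background support (`compMixKerG_eq_zero_bg`); this file supplies the rest.

WHAT (brick-generic §1–§2 over abstract bricks `ℓ 𝓋 𝒽 𝓉`; §3 at an1's (0.4)-SYM bricks at one root `toSite r`; [folklore] finite sums and one induction BY NAME; no `def`,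
no `def … : Prop`, nothing cited, 0 sorry):
§1 `compMixKerG_eq_zero_left ∕ _right` (support in the fluctuation bonds); §2 **`compMixKerG_sh`** (covariance: finest bonds by `L^m•t`, level-`m` bond by `t`),
`compMixFFG_translate ∕ compMixFFG_hmixt` (the packed graded table, (Tmix) byte shape at blocking `L^m`); §3 `compMixG_translate` ((Tmix) for (F0)'s `compMixG r L m`, the
brick letters `symLinKerAt_add ∕ symVhKerAt_add ∕ symHessKerAt_add ∕ symMixKerAt_add` discharged by name), `compMixG_one` (ANCHOR: `compMixG r L 1 = symMixFFAt (toSite r) L`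
— (F0) `compMixKerG_one` + F6c-2 `compMixFF_sym_one`: at depth one the graded table IS the literal's `mixFF` slot, as `compMix` is).
WHAT THIS IS NOT: not the periodisation (PART 79b); not a bound (F6c-2's `abs_compMixKer_le` pattern applies verbatim when a consumer asks); nothing of Bałaban's asserted,
valued or discharged; 0 estimates; 0∕4 row-D1 binders (hW, hR, D1Tel, D1Rep); ROOT M‴ p325680 ∕ P5c ∕ D6 untouched; NOT (C1), NOT (T-ID), NOT D1, NEVER «G-an2-4 closed»,
NOT BetaPertH, NOT continuum, NOT Clay.

HONEST DEPENDENCY (page 1, mandatory): continuum YM on T⁴ ⇐ BetaPertH ∧ nine spine estimates (0/9 proved); BetaPertH ⇐ (D1) ∧ (D4) ∧ CAP+tail;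
G-an2-4 gates asym, D1 and NE2/3/4.  HONEST FRAMING (cell contract, verbatim): «discharging `BetaPertH` makes Bałaban's UV stability UNCONDITIONAL —
a real constructive-QFT result; it is NOT the continuum limit and NOT the Clay problem.»  ABSOLUTE RULE (cell charter, verbatim): «No internally-minted
statement may enter as a cited fact. Every hypothesis is either kernel-proved in this package or a verbatim quotation of a PUBLISHED theorem with page
reference. The manuscript(s) under audit are NOT citable for their own disputed steps — they are the thing under adjudication; programme-internal
(2001/route/tribunal) claims are never citable.»  Row D1 ∕ (C1) OWNER an2 (b2b-balaban-beta-an2) gen 81, 2026-08-29.  Proofs = F6c's with six name swaps each.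
No existing file touched.
-/

noncomputable section

open scoped BigOperators

namespace Summit.QuantumFields.BalabanUV.Beta.CompositeMixedTableGradedCov

open Finset
open Literature.MathematicalPhysics.QuantumFieldTheory.Balaban1983to89
open Literature.MathematicalPhysics.QuantumFieldTheory.Balaban1983to89.Beta
open AffineAveraging (Site box toSite)
open AveragingHessianKernels (Bond)
open ExpKernelCalculus (MKer shiftK)
open OneStepResolventKernel (Fib)
open Summit.QuantumFields.BalabanUV.Beta.SymAveragingHessianCounts (symLinKerAt symVhKerAt symHessKerAt symLinKerAt_add symVhKerAt_add symHessKerAt_add)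
open Summit.QuantumFields.BalabanUV.Beta.SymAveragingMixedJetTables (symMixKerAt symMixFFAt symMixKerAt_add)
open Summit.QuantumFields.BalabanUV.Beta.CompositeVertexKernelRec (offs winF wid compLinKer compVHKer compLinKer_eq_zero compVHKer_eq_zero_left compVHKer_eq_zero_right
  mem_winF_succ_of_offs window_bond_sh compLinKer_sh compVHKer_sh)
open Summit.QuantumFields.BalabanUV.Beta.CompositeMixedTable (compMixFF_sym_one)
open Summit.QuantumFields.BalabanUV.Beta.CompositeMixedTableGraded (compMixKerG compMixFFG compMixG compMixKerG_zero compMixKerG_succ compMixFFG_inl_inl compMixKerG_one)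
open Summit.QuantumFields.BalabanUV.Beta.CompositeOneShotJets (compMix)

variable {d : ℕ}

section Generic

variable {ℓ : ℕ → Fin (d + 1) → Site (d + 1) → Bond (d + 1) → ℝ}
  {𝓋 𝒽 : ℕ → Fin (d + 1) → Site (d + 1) → Bond (d + 1) → Bond (d + 1) → ℝ}
  {𝓉 : ℕ → Fin (d + 1) → Site (d + 1) → Bond (d + 1) → Bond (d + 1) → Bond (d + 1) → ℝ} {L : ℕ}

/-! ## §1 Support in the fluctuation bonds -/

/-- [folklore] SUPPORT OF THE GRADED KERNEL IN THE FIRST FLUCTUATION BOND (F6c `compMixKer_eq_zero_left` for (F0)'s recursion). -/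
theorem compMixKerG_eq_zero_left : ∀ (m : ℕ) {μ : Fin (d + 1)} {y : Site (d + 1)} (g : Bond (d + 1)) {f : Bond (d + 1)} (f' : Bond (d + 1)),
    f.2 ∉ winF (L ^ m) (wid L m) y → compMixKerG ℓ 𝓋 𝒽 𝓉 L m μ y g f f' = 0
  | 0, _, _, _, _, _, _ => rfl
  | m + 1, μ, y, g, f, f', h => by
      rw [compMixKerG_succ]
      have A : ∀ κ, ∀ e ∈ offs L, compLinKer ℓ L m f (κ, (L : ℤ) • y + e) = 0 :=
        fun κ e he => compLinKer_eq_zero m fun hn => h (mem_winF_succ_of_offs he hn)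
      have B : ∀ κ, ∀ e ∈ offs L, compVHKer ℓ 𝓋 L m κ ((L : ℤ) • y + e) f g = 0 :=
        fun κ e he => compVHKer_eq_zero_left m g fun hn => h (mem_winF_succ_of_offs he hn)
      have B' : ∀ κ, ∀ e ∈ offs L, compVHKer ℓ 𝒽 L m κ ((L : ℤ) • y + e) f f' = 0 :=
        fun κ e he => compVHKer_eq_zero_left m f' fun hn => h (mem_winF_succ_of_offs he hn)
      have C : ∀ κ, ∀ e ∈ offs L, compMixKerG ℓ 𝓋 𝒽 𝓉 L m κ ((L : ℤ) • y + e) g f f' = 0 :=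
        fun κ e he => compMixKerG_eq_zero_left m g f' fun hn => h (mem_winF_succ_of_offs he hn)
      have S1 : (∑ κ : Fin (d + 1), ∑ e ∈ offs L, ∑ κ₁ : Fin (d + 1), ∑ e₁ ∈ offs L, ∑ κ₂ : Fin (d + 1), ∑ e₂ ∈ offs L,
          𝓉 m μ y (κ, (L : ℤ) • y + e) (κ₁, (L : ℤ) • y + e₁) (κ₂, (L : ℤ) • y + e₂)
            * compLinKer ℓ L m g (κ, (L : ℤ) • y + e) * compLinKer ℓ L m f (κ₁, (L : ℤ) • y + e₁)
            * compLinKer ℓ L m f' (κ₂, (L : ℤ) • y + e₂)) = 0 :=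
        Finset.sum_eq_zero fun κ _ => Finset.sum_eq_zero fun e _ => Finset.sum_eq_zero fun κ₁ _ => Finset.sum_eq_zero fun e₁ he₁ =>
          Finset.sum_eq_zero fun κ₂ _ => Finset.sum_eq_zero fun e₂ _ => by rw [A κ₁ e₁ he₁, mul_zero, zero_mul]
      have S2 : (∑ κ₁ : Fin (d + 1), ∑ e₁ ∈ offs L, ∑ κ₂ : Fin (d + 1), ∑ e₂ ∈ offs L,
          𝒽 m μ y (κ₁, (L : ℤ) • y + e₁) (κ₂, (L : ℤ) • y + e₂)
            * compVHKer ℓ 𝓋 L m κ₁ ((L : ℤ) • y + e₁) f g * compLinKer ℓ L m f' (κ₂, (L : ℤ) • y + e₂)) = 0 :=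
        Finset.sum_eq_zero fun κ₁ _ => Finset.sum_eq_zero fun e₁ he₁ => Finset.sum_eq_zero fun κ₂ _ => Finset.sum_eq_zero fun e₂ _ => by
          rw [B κ₁ e₁ he₁, mul_zero, zero_mul]
      have S3 : (∑ κ₁ : Fin (d + 1), ∑ e₁ ∈ offs L, ∑ κ₂ : Fin (d + 1), ∑ e₂ ∈ offs L,
          𝒽 m μ y (κ₁, (L : ℤ) • y + e₁) (κ₂, (L : ℤ) • y + e₂)
            * compLinKer ℓ L m f (κ₁, (L : ℤ) • y + e₁) * compVHKer ℓ 𝓋 L m κ₂ ((L : ℤ) • y + e₂) f' g) = 0 :=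
        Finset.sum_eq_zero fun κ₁ _ => Finset.sum_eq_zero fun e₁ he₁ => Finset.sum_eq_zero fun κ₂ _ => Finset.sum_eq_zero fun e₂ _ => by
          rw [A κ₁ e₁ he₁, mul_zero, zero_mul]
      have S4 : (∑ κ₁ : Fin (d + 1), ∑ e₁ ∈ offs L, ∑ κ : Fin (d + 1), ∑ e ∈ offs L,
          𝓋 m μ y (κ₁, (L : ℤ) • y + e₁) (κ, (L : ℤ) • y + e)
            * compVHKer ℓ 𝒽 L m κ₁ ((L : ℤ) • y + e₁) f f' * compLinKer ℓ L m g (κ, (L : ℤ) • y + e)) = 0 :=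
        Finset.sum_eq_zero fun κ₁ _ => Finset.sum_eq_zero fun e₁ he₁ => Finset.sum_eq_zero fun κ _ => Finset.sum_eq_zero fun e _ => by
          rw [B' κ₁ e₁ he₁, mul_zero, zero_mul]
      have S5 : (∑ κ : Fin (d + 1), ∑ e ∈ offs L, ℓ m μ y (κ, (L : ℤ) • y + e) * compMixKerG ℓ 𝓋 𝒽 𝓉 L m κ ((L : ℤ) • y + e) g f f') = 0 :=
        Finset.sum_eq_zero fun κ _ => Finset.sum_eq_zero fun e he => by rw [C κ e he, mul_zero]
      rw [S1, S2, S3, S4, S5]; ring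

/-- [folklore] SUPPORT OF THE GRADED KERNEL IN THE SECOND FLUCTUATION BOND (F6c `compMixKer_eq_zero_right`). -/
theorem compMixKerG_eq_zero_right : ∀ (m : ℕ) {μ : Fin (d + 1)} {y : Site (d + 1)} (g f : Bond (d + 1)) {f' : Bond (d + 1)},
    f'.2 ∉ winF (L ^ m) (wid L m) y → compMixKerG ℓ 𝓋 𝒽 𝓉 L m μ y g f f' = 0
  | 0, _, _, _, _, _, _ => rfl
  | m + 1, μ, y, g, f, f', h => by
      rw [compMixKerG_succ]
      have A : ∀ κ, ∀ e ∈ offs L, compLinKer ℓ L m f' (κ, (L : ℤ) • y + e) = 0 :=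
        fun κ e he => compLinKer_eq_zero m fun hn => h (mem_winF_succ_of_offs he hn)
      have B : ∀ κ, ∀ e ∈ offs L, compVHKer ℓ 𝓋 L m κ ((L : ℤ) • y + e) f' g = 0 :=
        fun κ e he => compVHKer_eq_zero_left m g fun hn => h (mem_winF_succ_of_offs he hn)
      have B' : ∀ κ, ∀ e ∈ offs L, compVHKer ℓ 𝒽 L m κ ((L : ℤ) • y + e) f f' = 0 :=
        fun κ e he => compVHKer_eq_zero_right m f fun hn => h (mem_winF_succ_of_offs he hn)
      have C : ∀ κ, ∀ e ∈ offs L, compMixKerG ℓ 𝓋 𝒽 𝓉 L m κ ((L : ℤ) • y + e) g f f' = 0 :=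
        fun κ e he => compMixKerG_eq_zero_right m g f fun hn => h (mem_winF_succ_of_offs he hn)
      have S1 : (∑ κ : Fin (d + 1), ∑ e ∈ offs L, ∑ κ₁ : Fin (d + 1), ∑ e₁ ∈ offs L, ∑ κ₂ : Fin (d + 1), ∑ e₂ ∈ offs L,
          𝓉 m μ y (κ, (L : ℤ) • y + e) (κ₁, (L : ℤ) • y + e₁) (κ₂, (L : ℤ) • y + e₂)
            * compLinKer ℓ L m g (κ, (L : ℤ) • y + e) * compLinKer ℓ L m f (κ₁, (L : ℤ) • y + e₁)
            * compLinKer ℓ L m f' (κ₂, (L : ℤ) • y + e₂)) = 0 :=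
        Finset.sum_eq_zero fun κ _ => Finset.sum_eq_zero fun e _ => Finset.sum_eq_zero fun κ₁ _ => Finset.sum_eq_zero fun e₁ _ =>
          Finset.sum_eq_zero fun κ₂ _ => Finset.sum_eq_zero fun e₂ he₂ => by rw [A κ₂ e₂ he₂, mul_zero]
      have S2 : (∑ κ₁ : Fin (d + 1), ∑ e₁ ∈ offs L, ∑ κ₂ : Fin (d + 1), ∑ e₂ ∈ offs L,
          𝒽 m μ y (κ₁, (L : ℤ) • y + e₁) (κ₂, (L : ℤ) • y + e₂)
            * compVHKer ℓ 𝓋 L m κ₁ ((L : ℤ) • y + e₁) f g * compLinKer ℓ L m f' (κ₂, (L : ℤ) • y + e₂)) = 0 :=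
        Finset.sum_eq_zero fun κ₁ _ => Finset.sum_eq_zero fun e₁ _ => Finset.sum_eq_zero fun κ₂ _ => Finset.sum_eq_zero fun e₂ he₂ => by
          rw [A κ₂ e₂ he₂, mul_zero]
      have S3 : (∑ κ₁ : Fin (d + 1), ∑ e₁ ∈ offs L, ∑ κ₂ : Fin (d + 1), ∑ e₂ ∈ offs L,
          𝒽 m μ y (κ₁, (L : ℤ) • y + e₁) (κ₂, (L : ℤ) • y + e₂)
            * compLinKer ℓ L m f (κ₁, (L : ℤ) • y + e₁) * compVHKer ℓ 𝓋 L m κ₂ ((L : ℤ) • y + e₂) f' g) = 0 :=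
        Finset.sum_eq_zero fun κ₁ _ => Finset.sum_eq_zero fun e₁ _ => Finset.sum_eq_zero fun κ₂ _ => Finset.sum_eq_zero fun e₂ he₂ => by
          rw [B κ₂ e₂ he₂, mul_zero]
      have S4 : (∑ κ₁ : Fin (d + 1), ∑ e₁ ∈ offs L, ∑ κ : Fin (d + 1), ∑ e ∈ offs L,
          𝓋 m μ y (κ₁, (L : ℤ) • y + e₁) (κ, (L : ℤ) • y + e)
            * compVHKer ℓ 𝒽 L m κ₁ ((L : ℤ) • y + e₁) f f' * compLinKer ℓ L m g (κ, (L : ℤ) • y + e)) = 0 :=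
        Finset.sum_eq_zero fun κ₁ _ => Finset.sum_eq_zero fun e₁ he₁ => Finset.sum_eq_zero fun κ _ => Finset.sum_eq_zero fun e _ => by
          rw [B' κ₁ e₁ he₁, mul_zero, zero_mul]
      have S5 : (∑ κ : Fin (d + 1), ∑ e ∈ offs L, ℓ m μ y (κ, (L : ℤ) • y + e) * compMixKerG ℓ 𝓋 𝒽 𝓉 L m κ ((L : ℤ) • y + e) g f f') = 0 :=
        Finset.sum_eq_zero fun κ _ => Finset.sum_eq_zero fun e he => by rw [C κ e he, mul_zero]
      rw [S1, S2, S3, S4, S5]; ring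

/-! ## §2 Block-translation covariance; the packed graded table -/

/-- [folklore] COVARIANCE OF THE GRADED COMPOSITE MIXED KERNEL under block translations (finest bonds by `L^m·t`, level-`m` bond by `t`) — F6c `compMixKer_sh`. -/
theorem compMixKerG_sh (hℓsh : ∀ m μ y t f, ℓ m μ (y + t) (f.sh ((L : ℤ) • t)) = ℓ m μ y f)
    (h𝓋sh : ∀ m μ y t f f', 𝓋 m μ (y + t) (f.sh ((L : ℤ) • t)) (f'.sh ((L : ℤ) • t)) = 𝓋 m μ y f f')
    (h𝒽sh : ∀ m μ y t f f', 𝒽 m μ (y + t) (f.sh ((L : ℤ) • t)) (f'.sh ((L : ℤ) • t)) = 𝒽 m μ y f f')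
    (h𝓉sh : ∀ m μ y t g f f', 𝓉 m μ (y + t) (g.sh ((L : ℤ) • t)) (f.sh ((L : ℤ) • t)) (f'.sh ((L : ℤ) • t)) = 𝓉 m μ y g f f')
    (m : ℕ) (g f f' : Bond (d + 1)) :
    ∀ (μ : Fin (d + 1)) (y t : Site (d + 1)),
      compMixKerG ℓ 𝓋 𝒽 𝓉 L m μ (y + t) (g.sh ((L : ℤ) ^ m • t)) (f.sh ((L : ℤ) ^ m • t)) (f'.sh ((L : ℤ) ^ m • t))
        = compMixKerG ℓ 𝓋 𝒽 𝓉 L m μ y g f f' := by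
  induction m with
  | zero => intro μ y t; rw [compMixKerG_zero, compMixKerG_zero]
  | succ m ih =>
      intro μ y t
      rw [compMixKerG_succ, compMixKerG_succ]
      have e3 : (L : ℤ) ^ (m + 1) • t = (L : ℤ) ^ m • ((L : ℤ) • t) := by rw [pow_succ, mul_smul]
      have e4 : ∀ e : Site (d + 1), (L : ℤ) • (y + t) + e = ((L : ℤ) • y + e) + (L : ℤ) • t := fun e => by
        rw [smul_add]; abel
      have T1 : ∀ κ κ₁ κ₂ (e e₁ e₂ : Site (d + 1)),
          𝓉 m μ (y + t) (κ, (L : ℤ) • (y + t) + e) (κ₁, (L : ℤ) • (y + t) + e₁) (κ₂, (L : ℤ) • (y + t) + e₂)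
            * compLinKer ℓ L m (g.sh ((L : ℤ) ^ (m + 1) • t)) (κ, (L : ℤ) • (y + t) + e)
            * compLinKer ℓ L m (f.sh ((L : ℤ) ^ (m + 1) • t)) (κ₁, (L : ℤ) • (y + t) + e₁)
            * compLinKer ℓ L m (f'.sh ((L : ℤ) ^ (m + 1) • t)) (κ₂, (L : ℤ) • (y + t) + e₂)
          = 𝓉 m μ y (κ, (L : ℤ) • y + e) (κ₁, (L : ℤ) • y + e₁) (κ₂, (L : ℤ) • y + e₂)
            * compLinKer ℓ L m g (κ, (L : ℤ) • y + e) * compLinKer ℓ L m f (κ₁, (L : ℤ) • y + e₁)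
            * compLinKer ℓ L m f' (κ₂, (L : ℤ) • y + e₂) := by
        intro κ κ₁ κ₂ e e₁ e₂
        rw [window_bond_sh L κ, window_bond_sh L κ₁, window_bond_sh L κ₂, h𝓉sh, e3, compLinKer_sh hℓsh, compLinKer_sh hℓsh,
          compLinKer_sh hℓsh]
      have T2 : ∀ κ₁ κ₂ (e₁ e₂ : Site (d + 1)) (a c c' : Bond (d + 1)),
          𝒽 m μ (y + t) (κ₁, (L : ℤ) • (y + t) + e₁) (κ₂, (L : ℤ) • (y + t) + e₂)
            * compVHKer ℓ 𝓋 L m κ₁ ((L : ℤ) • (y + t) + e₁) (a.sh ((L : ℤ) ^ (m + 1) • t)) (c.sh ((L : ℤ) ^ (m + 1) • t))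
            * compLinKer ℓ L m (c'.sh ((L : ℤ) ^ (m + 1) • t)) (κ₂, (L : ℤ) • (y + t) + e₂)
          = 𝒽 m μ y (κ₁, (L : ℤ) • y + e₁) (κ₂, (L : ℤ) • y + e₂)
            * compVHKer ℓ 𝓋 L m κ₁ ((L : ℤ) • y + e₁) a c * compLinKer ℓ L m c' (κ₂, (L : ℤ) • y + e₂) := by
        intro κ₁ κ₂ e₁ e₂ a c c'
        rw [window_bond_sh L κ₁, window_bond_sh L κ₂, h𝒽sh, e3, compLinKer_sh hℓsh, e4 e₁, compVHKer_sh hℓsh h𝓋sh]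
      have T3 : ∀ κ₁ κ₂ (e₁ e₂ : Site (d + 1)) (a c c' : Bond (d + 1)),
          𝒽 m μ (y + t) (κ₁, (L : ℤ) • (y + t) + e₁) (κ₂, (L : ℤ) • (y + t) + e₂)
            * compLinKer ℓ L m (c'.sh ((L : ℤ) ^ (m + 1) • t)) (κ₁, (L : ℤ) • (y + t) + e₁)
            * compVHKer ℓ 𝓋 L m κ₂ ((L : ℤ) • (y + t) + e₂) (a.sh ((L : ℤ) ^ (m + 1) • t)) (c.sh ((L : ℤ) ^ (m + 1) • t))
          = 𝒽 m μ y (κ₁, (L : ℤ) • y + e₁) (κ₂, (L : ℤ) • y + e₂)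
            * compLinKer ℓ L m c' (κ₁, (L : ℤ) • y + e₁) * compVHKer ℓ 𝓋 L m κ₂ ((L : ℤ) • y + e₂) a c := by
        intro κ₁ κ₂ e₁ e₂ a c c'
        rw [window_bond_sh L κ₁, window_bond_sh L κ₂, h𝒽sh, e3, compLinKer_sh hℓsh, e4 e₂, compVHKer_sh hℓsh h𝓋sh]
      have T4 : ∀ κ₁ κ (e₁ e : Site (d + 1)) (a c c' : Bond (d + 1)),
          𝓋 m μ (y + t) (κ₁, (L : ℤ) • (y + t) + e₁) (κ, (L : ℤ) • (y + t) + e)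
            * compVHKer ℓ 𝒽 L m κ₁ ((L : ℤ) • (y + t) + e₁) (a.sh ((L : ℤ) ^ (m + 1) • t)) (c.sh ((L : ℤ) ^ (m + 1) • t))
            * compLinKer ℓ L m (c'.sh ((L : ℤ) ^ (m + 1) • t)) (κ, (L : ℤ) • (y + t) + e)
          = 𝓋 m μ y (κ₁, (L : ℤ) • y + e₁) (κ, (L : ℤ) • y + e)
            * compVHKer ℓ 𝒽 L m κ₁ ((L : ℤ) • y + e₁) a c * compLinKer ℓ L m c' (κ, (L : ℤ) • y + e) := by
        intro κ₁ κ e₁ e a c c'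
        rw [window_bond_sh L κ₁, window_bond_sh L κ, h𝓋sh, e3, compLinKer_sh hℓsh, e4 e₁, compVHKer_sh hℓsh h𝒽sh]
      have T5 : ∀ κ (e : Site (d + 1)),
          ℓ m μ (y + t) (κ, (L : ℤ) • (y + t) + e)
            * compMixKerG ℓ 𝓋 𝒽 𝓉 L m κ ((L : ℤ) • (y + t) + e) (g.sh ((L : ℤ) ^ (m + 1) • t)) (f.sh ((L : ℤ) ^ (m + 1) • t))
                (f'.sh ((L : ℤ) ^ (m + 1) • t))
          = ℓ m μ y (κ, (L : ℤ) • y + e) * compMixKerG ℓ 𝓋 𝒽 𝓉 L m κ ((L : ℤ) • y + e) g f f' := by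
        intro κ e
        rw [window_bond_sh, hℓsh, e3, e4 e, ih κ ((L : ℤ) • y + e) ((L : ℤ) • t)]
      simp_rw [T1, T2, T3, T4, T5]

/-- [folklore] **(Tmix)-SHAPE COVARIANCE OF THE PACKED GRADED TABLE**: background bond by `L^m·t`, level-`m` bond by `t` (F6c `compMixFF_translate`). -/
theorem compMixFFG_translate (hℓsh : ∀ m μ y t f, ℓ m μ (y + t) (f.sh ((L : ℤ) • t)) = ℓ m μ y f)
    (h𝓋sh : ∀ m μ y t f f', 𝓋 m μ (y + t) (f.sh ((L : ℤ) • t)) (f'.sh ((L : ℤ) • t)) = 𝓋 m μ y f f')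
    (h𝒽sh : ∀ m μ y t f f', 𝒽 m μ (y + t) (f.sh ((L : ℤ) • t)) (f'.sh ((L : ℤ) • t)) = 𝒽 m μ y f f')
    (h𝓉sh : ∀ m μ y t g f f', 𝓉 m μ (y + t) (g.sh ((L : ℤ) • t)) (f.sh ((L : ℤ) • t)) (f'.sh ((L : ℤ) • t)) = 𝓉 m μ y g f f')
    (m : ℕ) (κ : Fin (d + 1)) (u : Site (d + 1)) (μ : Fin (d + 1)) (y t : Site (d + 1)) :
    compMixFFG ℓ 𝓋 𝒽 𝓉 L m κ (u + ((L ^ m : ℕ) : ℤ) • t) μ (y + t) = shiftK (-(((L ^ m : ℕ) : ℤ) • t)) (compMixFFG ℓ 𝓋 𝒽 𝓉 L m κ u μ y) := by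
  funext x x' a b
  simp only [shiftK]
  rcases a with α | ν
  · rcases b with α' | ν'
    · rw [compMixFFG_inl_inl, compMixFFG_inl_inl, Nat.cast_pow]
      have h := compMixKerG_sh hℓsh h𝓋sh h𝒽sh h𝓉sh m ((κ, u) : Bond (d + 1)) (α, x + -((L : ℤ) ^ m • t))
        (α', x' + -((L : ℤ) ^ m • t)) μ y t
      simp only [Bond.sh, neg_add_cancel_right] at h
      exact h
    · rfl
  · cases b <;> rfl

/-- [folklore] **(Tmix) in the record's letter shape** (F6c `compMixFF_hmixt`). -/
theorem compMixFFG_hmixt (hℓsh : ∀ m μ y t f, ℓ m μ (y + t) (f.sh ((L : ℤ) • t)) = ℓ m μ y f)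
    (h𝓋sh : ∀ m μ y t f f', 𝓋 m μ (y + t) (f.sh ((L : ℤ) • t)) (f'.sh ((L : ℤ) • t)) = 𝓋 m μ y f f')
    (h𝒽sh : ∀ m μ y t f f', 𝒽 m μ (y + t) (f.sh ((L : ℤ) • t)) (f'.sh ((L : ℤ) • t)) = 𝒽 m μ y f f')
    (h𝓉sh : ∀ m μ y t g f f', 𝓉 m μ (y + t) (g.sh ((L : ℤ) • t)) (f.sh ((L : ℤ) • t)) (f'.sh ((L : ℤ) • t)) = 𝓉 m μ y g f f') (m : ℕ) :
    ∀ (κ : Fin (d + 1)) (u : Site (d + 1)) (μ : Fin (d + 1)) (w t : Site (d + 1)),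
      compMixFFG ℓ 𝓋 𝒽 𝓉 L m κ (u + ((L ^ m : ℕ) : ℤ) • t) μ (w + t) = shiftK (-(((L ^ m : ℕ) : ℤ) • t)) (compMixFFG ℓ 𝓋 𝒽 𝓉 L m κ u μ w) :=
  fun κ u μ w t => compMixFFG_translate hℓsh h𝓋sh h𝒽sh h𝓉sh m κ u μ w t

end Generic

/-! ## §3 The (0.4)-symmetrised family `compMixG r L m`: covariance and the depth-one anchor -/

section Sym

variable {L : ℕ} {r : Fin (d + 1) → ℕ}

/-- [folklore] **(Tmix) FOR (F0)'s `compMixG r L m`** at blocking `L^m`: the brick letters `symLinKerAt_add ∕ symVhKerAt_add ∕ symHessKerAt_add ∕ symMixKerAt_add` discharged by name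
(F6c-2 `compMixFF_sym_translate` one sign over; `CompositeOneShotJets.compMix_hmixt`'s graded twin). -/
theorem compMixG_translate (m : ℕ) (κ : Fin (d + 1)) (u : Site (d + 1)) (μ : Fin (d + 1)) (y t : Site (d + 1)) :
    compMixG r L m κ (u + ((L ^ m : ℕ) : ℤ) • t) μ (y + t) = shiftK (-(((L ^ m : ℕ) : ℤ) • t)) (compMixG r L m κ u μ y) :=
  compMixFFG_translate (ℓ := fun _ => symLinKerAt (toSite r) L) (𝓋 := fun _ => symVhKerAt (toSite r) L)
    (𝒽 := fun _ => symHessKerAt (toSite r) L) (𝓉 := fun _ => symMixKerAt (toSite r) L)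
    (fun _ μ y t f => symLinKerAt_add (toSite r) L μ y t f)
    (fun _ μ y t f f' => symVhKerAt_add (toSite r) L μ y t f f')
    (fun _ μ y t f f' => symHessKerAt_add (toSite r) L μ y t f f')
    (fun _ μ y t g f f' => symMixKerAt_add (toSite r) L μ y t g f f') m κ u μ y t

/-- [folklore] **ANCHOR: AT DEPTH ONE THE GRADED TABLE IS THE LITERAL's `mixFF` SLOT** — `compMixG r L 1 = symMixFFAt (toSite r) L` (box root): (F0) `compMixKerG_one` (no lower
composite ⇒ no cross word) then F6c-2 `compMixFF_sym_one`; equivalently `compMixG r L 1 = compMix r L 1` (`CompositeOneShotJets.compMix_one`). -/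
theorem compMixG_one (hr : r ∈ box (d + 1) L) : compMixG r L 1 = symMixFFAt (toSite r) L := by
  rw [← compMixFF_sym_one hr]
  funext κ u μ y x x' a b
  rcases a with α | ν
  · rcases b with α' | ν'
    · rw [CompositeMixedTableGraded.compMixG_inl_inl, CompositeMixedTable.compMixFF_inl_inl]
      exact compMixKerG_one μ y (κ, u) (α, x) (α', x')
    · rfl
  · cases b <;> rfl

/-- [folklore] The same against (F6c's) `compMix r L 1`. -/
theorem compMixG_one_eq_compMix_one (hr : r ∈ box (d + 1) L) : compMixG r L 1 = compMix r L 1 := by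
  rw [compMixG_one hr, CompositeOneShotJets.compMix_one hr]

end Sym

end Summit.QuantumFields.BalabanUV.Beta.CompositeMixedTableGradedCov

end
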